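import Summits.NavierStokesRegularity.NavierStokesRegularity.Theorems.GaldiLiouvilleGateGaldiLiouvilleDriftMaximumPrinciple
import Literature.Analysis.FluidPDE.TsaiSelfSimilarPressureProofs
import Literature.Analysis.FluidPDE.TsaiHeadPressureIdentity
import Literature.Analysis.FluidPDE.AxisymmetricEuler
import Mathlib.Analysis.Distribution.AEEqOfIntegralContDiff
import HarnessLib

/-!
# GaldiLiouvilleGateGaldiLiouvilleAxialRigidity — census row S1 ⟨0895⟩ `GaldiLiouville`, line «allaxes»
# (ns-idea-4 g8), support **O2 `AxialRigidity`** (GENERAL: no symmetry)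

Seat ns-s29-p2 g3 (DIRECTOR-NS #209 (2)); statement VERBATIM = the body of `def AxialRigidity` of the line skeleton
`pub/ideators/ns-idea-4/lines/allaxes/GaldiLiouville_allaxes_v1.lean` (sha16 a43dd9fd9097dedf, l.121) with the files-only
bundle `IsDSolution` and the functional `axialEnergyIn` unfolded to their bodies (the skeleton closes O2 by
`exact axialRigidity`; convention of the sibling file `…AxisymGaldiLiouvilleAxialRigidity` of line cylbudget).  Critic of
record idea-crit-3 (10:53:19Z: «∂₃p = 0, p → p_∞ ⇒ p ≡ p_∞, then νΔ|u|² − u·∇|u|² ≥ 0 with |u|² → 0 ⇒ u ≡ 0»); lane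
arbiter ns-in-ser-a g2.  `--supports stmt-NavierStokesRegularity-0895 --as helper`.

**O2 (general).**  A smooth D-solution `(U, P)` of the steady Navier–Stokes system on `ℝ³` (`IsLerayProfile ν 0`, `ν > 0`,
finite Dirichlet integral, `U → 0` at infinity — NO axisymmetry) whose axial energy vanishes on every solid cylinder
about the `x₃`-axis is identically zero.

PROOF (no pressure-limit fact, no stream function):
1. `u₃ ≡ 0`: a null integral of the continuous nonnegative density `u₃²` on `{r ≤ t}` vanishes on the open `{r < t}`
   (`Measure.eqOn_open_of_ae_eq`; the sibling file's step 1 verbatim).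
2. `∂₃P ≡ 0`: Tsai's tested pressure identity `∫ θ ∂ₑP = ν∫ Δθ ⟪U,e⟫ + ∫ (U·∇θ)⟪U,e⟫` (tree
   `IsLerayProfile.integral_mul_fderiv_pressure`, `a = 0`) with `e = e₃` has vanishing right side, so `∂₃P = 0` a.e.
   (fundamental lemma, `ae_eq_zero_of_integral_contDiff_smul_eq_zero`) and everywhere by continuity.
3. `∇P ≡ 0`: `P` is invariant under vertical translations, so the vertically translated pair `(U(· + s e₃), P)` is again a
   steady solution; the same identity for it bounds `|∫ θ ∂ₑP|` by `(ν∫|Δθ| + ∫‖∇θ‖)·η` as soon as `‖U‖ ≤ η ≤ 1` on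
   `tsupport θ + s e₃`, which holds for large `s` (`U → 0` cocompactly); hence `∫ θ ∂ₑP = 0` for all tests and all `e`,
   and `P` is constant (`is_const_of_fderiv_eq_zero`).
4. `U ≡ 0`: with `P ≡ c` the head pressure `Π = ½|U|² + P` (Tsai) is a `C²` subsolution of `L = νΔ − U·∇`
   (`IsLerayProfile.driftOp_headPressure_nonneg`, Tsai 1998 (1.7)) tending to `c` at infinity; the perturbed weak maximum
   principle on large balls (sibling file `…GaldiLiouvilleDriftMaximumPrinciple`, `le_of_driftOp_nonneg_of_tendsto`:
   strict supersolution `e^{k|y − x₁|²}`, `k = M²/ν² + 1`, `M = sup|U|`) gives `Π ≤ c`, i.e. `U ≡ 0`.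

WHAT THIS IS NOT: a support of the RUNG `hoopEnergyLiouville_of` (O1 + O2 + O3 ⇒ «u_θ ∈ L² about one axis ⇒ U ≡ 0») of
line allaxes; neither ⟨0895⟩ `GaldiLiouville` (Galdi's Liouville problem), nor census row S1, nor Navier–Stokes regularity
is proved here. [folklore; Tsai1998 (1.7); GilbargTrudinger2001 §3.1]
-/

noncomputable section

open MeasureTheory Set Filter Topology Function Metric
open scoped ENNReal InnerProductSpace RealInnerProductSpace Laplacian ContDiff

set_option linter.dupNamespace false

namespace Summit.NavierStokesRegularity.NavierStokesRegularity.Theorems.GaldiLiouville.AllAxesBudget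

open Literature.Analysis.FluidPDE

/-! ## §1 Translation covariance of steady Leray profiles (`a = 0`) -/

/-- **Translation covariance of the steady profile system** (`a = 0`): `(U(· + v), P(· + v))` is again a Leray profile.
[folklore] -/
theorem isLerayProfile_comp_add_right {ν : ℝ} {U : EuclideanSpace ℝ (Fin 3) → EuclideanSpace ℝ (Fin 3)}
    {P : EuclideanSpace ℝ (Fin 3) → ℝ} (h : IsLerayProfile ν 0 U P) (v : EuclideanSpace ℝ (Fin 3)) :
    IsLerayProfile ν 0 (fun y => U (y + v)) (fun y => P (y + v)) where
  contDiff_velocity := h.contDiff_velocity.comp (contDiff_id.add contDiff_const)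
  contDiff_pressure := h.contDiff_pressure.comp (contDiff_id.add contDiff_const)
  profile_eq y := by
    have hc : convect (fun y => U (y + v)) (fun y => U (y + v)) y = convect U U (y + v) := by
      simp only [convect, fderiv_comp_add_right]
    have hg : gradient (fun y => P (y + v)) y = gradient P (y + v) := by
      rw [gradient, fderiv_comp_add_right, gradient]
    -- translation invariance of the Laplacian (as in the tree's `…Negative.TriWaveGauge.laplacian_comp_add_const`,
    -- inlined to keep this file's import closure inside the steady-NS literature)
    have hΔ : (Δ (fun y => U (y + v))) y = (Δ U) (y + v) := by
      rw [InnerProductSpace.laplacian_eq_iteratedFDeriv_orthonormalBasis _ (stdOrthonormalBasis ℝ _),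
        InnerProductSpace.laplacian_eq_iteratedFDeriv_orthonormalBasis U (stdOrthonormalBasis ℝ _)]
      simp only [iteratedFDeriv_comp_add_right]
    have h0 := h.profile_eq (y + v)
    simp only [zero_smul, add_zero] at h0 ⊢
    rw [hΔ, hc, hg]
    exact h0
  divFree y := by
    have h1 : VectorCalculus.divergence (fun y => U (y + v)) y = VectorCalculus.divergence U (y + v) := by
      rw [VectorCalculus.divergence, fderiv_comp_add_right, VectorCalculus.divergence]
    rw [h1]
    exact h.divFree (y + v)

/-! ## §2 The tested pressure identity at `a = 0` and its size -/

/-- Tsai's tested identity for a steady profile: `∫ θ ∂ₑP = ν ∫ Δθ ⟪U, e⟫ + ∫ (∇θ·U) ⟪U, e⟫`, every derivative on the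
test function. [cite: Tsai1998, Lemma 2.1] -/
theorem integral_mul_fderiv_pressure_zero {ν : ℝ} {U : EuclideanSpace ℝ (Fin 3) → EuclideanSpace ℝ (Fin 3)}
    {P : EuclideanSpace ℝ (Fin 3) → ℝ} (h : IsLerayProfile ν 0 U P) {θ : EuclideanSpace ℝ (Fin 3) → ℝ}
    (hθ : ContDiff ℝ 2 θ) (hθc : HasCompactSupport θ) (e : EuclideanSpace ℝ (Fin 3)) :
    ∫ x, θ x * fderiv ℝ P x e =
      ν * (∫ x, (Δ θ) x * ⟪U x, e⟫) + ∫ x, fderiv ℝ θ x (U x) * ⟪U x, e⟫ := by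
  have h1 := h.integral_mul_fderiv_pressure hθ hθc e
  simpa using h1

/-- The size of the tested identity: if `‖U‖ ≤ η ≤ 1` on `tsupport θ` then
`|∫ θ ∂ₑP| ≤ (|ν| ∫|Δθ| + ∫‖∇θ‖) ‖e‖ η`. [folklore] -/
theorem abs_integral_mul_fderiv_pressure_le {ν : ℝ} {U : EuclideanSpace ℝ (Fin 3) → EuclideanSpace ℝ (Fin 3)}
    {P : EuclideanSpace ℝ (Fin 3) → ℝ} (h : IsLerayProfile ν 0 U P) {θ : EuclideanSpace ℝ (Fin 3) → ℝ}
    (hθ : ContDiff ℝ 2 θ) (hθc : HasCompactSupport θ) (e : EuclideanSpace ℝ (Fin 3)) {η : ℝ}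
    (hη1 : η ≤ 1) (hU : ∀ x ∈ tsupport θ, ‖U x‖ ≤ η) :
    |∫ x, θ x * fderiv ℝ P x e| ≤
      (|ν| * (∫ x, |(Δ θ) x|) + ∫ x, ‖fderiv ℝ θ x‖) * ‖e‖ * η := by
  rw [integral_mul_fderiv_pressure_zero h hθ hθc e]
  have hθ1 : ContDiff ℝ 1 θ := hθ.of_le one_le_two
  have hΔc : Continuous (Δ θ) := Literature.Analysis.FluidPDE.continuous_laplacian hθ
  have hDc : Continuous (fderiv ℝ θ) := hθ1.continuous_fderiv one_ne_zero
  have hΔcs : HasCompactSupport (Δ θ) :=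
    HasCompactSupport.intro hθc fun x hx => Literature.Analysis.FluidPDE.laplacian_eq_zero_of_notMem_tsupport hx
  have hDcs : HasCompactSupport (fderiv ℝ θ) := hθc.fderiv (𝕜 := ℝ)
  -- `‖U x‖ ≤ η` wherever a derivative of `θ` is nonzero; off `tsupport θ` the integrands vanish
  have hb1 : ∀ x, ‖(Δ θ) x * ⟪U x, e⟫‖ ≤ |(Δ θ) x| * (‖e‖ * η) := by
    intro x
    rw [Real.norm_eq_abs, abs_mul]
    by_cases hx : x ∈ tsupport θ
    · refine mul_le_mul_of_nonneg_left ?_ (abs_nonneg _)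
      calc |⟪U x, e⟫| ≤ ‖U x‖ * ‖e‖ := abs_real_inner_le_norm _ _
        _ ≤ η * ‖e‖ := mul_le_mul_of_nonneg_right (hU x hx) (norm_nonneg _)
        _ = ‖e‖ * η := mul_comm _ _
    · rw [Literature.Analysis.FluidPDE.laplacian_eq_zero_of_notMem_tsupport hx, abs_zero, zero_mul, zero_mul]
  have hb2 : ∀ x, ‖fderiv ℝ θ x (U x) * ⟪U x, e⟫‖ ≤ ‖fderiv ℝ θ x‖ * (‖e‖ * η) := by
    intro x
    rw [Real.norm_eq_abs, abs_mul]
    by_cases hx : x ∈ tsupport θ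
    · have hUx := hU x hx
      calc |fderiv ℝ θ x (U x)| * |⟪U x, e⟫| ≤ (‖fderiv ℝ θ x‖ * ‖U x‖) * (‖U x‖ * ‖e‖) := by
            refine mul_le_mul ?_ (abs_real_inner_le_norm _ _) (abs_nonneg _) (by positivity)
            rw [← Real.norm_eq_abs]; exact ContinuousLinearMap.le_opNorm _ _
        _ ≤ (‖fderiv ℝ θ x‖ * 1) * (η * ‖e‖) := by
            refine mul_le_mul (mul_le_mul_of_nonneg_left (hUx.trans hη1) (norm_nonneg _))
              (mul_le_mul_of_nonneg_right hUx (norm_nonneg _)) (by positivity) (by positivity)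
        _ = ‖fderiv ℝ θ x‖ * (‖e‖ * η) := by ring
    · have hx' : x ∉ tsupport (fderiv ℝ θ) := fun h' => hx (tsupport_fderiv_subset ℝ h')
      rw [image_eq_zero_of_notMem_tsupport hx', zero_apply, abs_zero, zero_mul,
        norm_zero, zero_mul]
  have i1 : Integrable fun x => |(Δ θ) x| * (‖e‖ * η) :=
    ((continuous_abs.comp hΔc).mul continuous_const).integrable_of_hasCompactSupport
      ((hΔcs.norm.mul_right))
  have i2 : Integrable fun x => ‖fderiv ℝ θ x‖ * (‖e‖ * η) :=
    ((continuous_norm.comp hDc).mul continuous_const).integrable_of_hasCompactSupport (hDcs.norm.mul_right)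
  have e1 : ‖∫ x, (Δ θ) x * ⟪U x, e⟫‖ ≤ ∫ x, |(Δ θ) x| * (‖e‖ * η) :=
    norm_integral_le_of_norm_le i1 (Eventually.of_forall hb1)
  have e2 : ‖∫ x, fderiv ℝ θ x (U x) * ⟪U x, e⟫‖ ≤ ∫ x, ‖fderiv ℝ θ x‖ * (‖e‖ * η) :=
    norm_integral_le_of_norm_le i2 (Eventually.of_forall hb2)
  rw [integral_mul_const] at e1 e2
  rw [Real.norm_eq_abs] at e1 e2
  have hA : 0 ≤ ∫ x, |(Δ θ) x| := integral_nonneg fun x => abs_nonneg _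
  have hB : 0 ≤ ∫ x, ‖fderiv ℝ θ x‖ := integral_nonneg fun x => norm_nonneg _
  calc |ν * (∫ x, (Δ θ) x * ⟪U x, e⟫) + ∫ x, fderiv ℝ θ x (U x) * ⟪U x, e⟫|
      ≤ |ν * (∫ x, (Δ θ) x * ⟪U x, e⟫)| + |∫ x, fderiv ℝ θ x (U x) * ⟪U x, e⟫| := abs_add_le _ _
    _ = |ν| * |∫ x, (Δ θ) x * ⟪U x, e⟫| + |∫ x, fderiv ℝ θ x (U x) * ⟪U x, e⟫| := by rw [abs_mul]
    _ ≤ |ν| * ((∫ x, |(Δ θ) x|) * (‖e‖ * η)) + (∫ x, ‖fderiv ℝ θ x‖) * (‖e‖ * η) := by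
        gcongr
    _ = (|ν| * (∫ x, |(Δ θ) x|) + ∫ x, ‖fderiv ℝ θ x‖) * ‖e‖ * η := by ring

/-! ## §3 O2 by name -/

/-- **O2 `AxialRigidity`** (line allaxes, VERBATIM body of the skeleton's `def`, with the files-only bundle `IsDSolution`
and the functional `axialEnergyIn` unfolded): a smooth D-solution of the steady Navier–Stokes system on `ℝ³` (NO
symmetry) tending to `0` at infinity whose axial energy vanishes on every solid cylinder about the `x₃`-axis is
identically zero (module docstring, steps 1–4). [folklore; Tsai1998 (1.7); GilbargTrudinger2001 §3.1] -/
theorem axialRigidity :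
    ∀ ν : ℝ, 0 < ν → ∀ (U : EuclideanSpace ℝ (Fin 3) → EuclideanSpace ℝ (Fin 3)) (P : EuclideanSpace ℝ (Fin 3) → ℝ),
      (IsLerayProfile ν 0 U P ∧ ContDiff ℝ (⊤ : ℕ∞) U ∧ ContDiff ℝ (⊤ : ℕ∞) P ∧
        (∫⁻ y, ENNReal.ofReal (frobeniusNormSq (fderiv ℝ U y))) < ⊤ ∧
        Tendsto U (cocompact (EuclideanSpace ℝ (Fin 3))) (𝓝 0)) →
      (∀ t : ℝ, 0 < t →
        (∫⁻ x in {x : EuclideanSpace ℝ (Fin 3) | cylRadius x ≤ t}, ENNReal.ofReal (axialVelocity U x ^ 2)) = 0) →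
      U = 0 := by
  intro ν hν U P hsol h0
  obtain ⟨hprof, hU, -, -, hlim⟩ := hsol
  have hUc : Continuous U := hU.continuous
  have hP1 : ContDiff ℝ 1 P := hprof.contDiff_pressure
  have hPd : Differentiable ℝ P := hP1.differentiable one_ne_zero
  have hDPc : ∀ e : EuclideanSpace ℝ (Fin 3), Continuous fun x => fderiv ℝ P x e := fun e =>
    (hP1.continuous_fderiv one_ne_zero).clm_apply continuous_const
  -- ### Step 1: `u₃ ≡ 0` (sibling file's step, verbatim)
  have hUz : ∀ x, U x 2 = 0 := by
    intro x
    set t : ℝ := cylRadius x + 1 with ht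
    have ht0 : 0 < t := by have := cylRadius_nonneg x; linarith
    set f : EuclideanSpace ℝ (Fin 3) → ℝ≥0∞ := fun y => ENNReal.ofReal (axialVelocity U y ^ 2) with hf
    have hfc : Continuous f := by
      refine ENNReal.continuous_ofReal.comp ?_
      exact ((EuclideanSpace.proj (2 : Fin 3)).continuous.comp hUc).pow 2
    have hO : IsOpen {y : EuclideanSpace ℝ (Fin 3) | cylRadius y < t} :=
      isOpen_lt continuous_cylRadius continuous_const
    have hOS : {y : EuclideanSpace ℝ (Fin 3) | cylRadius y < t} ⊆ {y | cylRadius y ≤ t} :=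
      fun y (hy : cylRadius y < t) => show cylRadius y ≤ t from hy.le
    have hae : f =ᵐ[volume.restrict {y : EuclideanSpace ℝ (Fin 3) | cylRadius y ≤ t}] 0 :=
      (lintegral_eq_zero_iff hfc.measurable).1 (h0 t ht0)
    have hae' : f =ᵐ[volume.restrict {y : EuclideanSpace ℝ (Fin 3) | cylRadius y < t}] (fun _ => 0) :=
      ae_restrict_of_ae_restrict_of_subset hOS hae
    have hEq := Measure.eqOn_open_of_ae_eq hae' hO hfc.continuousOn continuousOn_const
    have hx : x ∈ {y : EuclideanSpace ℝ (Fin 3) | cylRadius y < t} := by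
      show cylRadius x < t; rw [ht]; linarith
    have h1 : f x = 0 := hEq hx
    rw [hf] at h1
    simp only [ENNReal.ofReal_eq_zero] at h1
    have h2 : axialVelocity U x ^ 2 = 0 := le_antisymm h1 (sq_nonneg _)
    exact pow_eq_zero_iff (two_ne_zero) |>.1 h2
  set e₃ : EuclideanSpace ℝ (Fin 3) := EuclideanSpace.single 2 1 with he₃_def
  have he₃n : ‖e₃‖ = 1 := by simp [he₃_def]
  have hinner3 : ∀ x, ⟪U x, e₃⟫ = 0 := by
    intro x
    rw [he₃_def, EuclideanSpace.inner_single_right]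
    simp [hUz x]
  -- from a.e. to everywhere for the continuous partial derivatives of `P`
  have hall_of_ae : ∀ e : EuclideanSpace ℝ (Fin 3), (∀ᵐ x ∂(volume : Measure (EuclideanSpace ℝ (Fin 3))),
      fderiv ℝ P x e = 0) → ∀ x, fderiv ℝ P x e = 0 := by
    intro e hae x
    have h := ((hDPc e).ae_eq_iff_eq volume continuous_const).1 hae
    exact congrFun h x
  -- smooth tests are `C²`
  have h2le : ∀ {g : EuclideanSpace ℝ (Fin 3) → ℝ}, ContDiff ℝ ∞ g → ContDiff ℝ 2 g := fun hg =>
    contDiff_infty.1 hg 2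
  -- ### Step 2: `∂₃P ≡ 0`
  have hD3 : ∀ x, fderiv ℝ P x e₃ = 0 := by
    refine hall_of_ae e₃ (ae_eq_zero_of_integral_contDiff_smul_eq_zero (hDPc e₃).locallyIntegrable ?_)
    intro g hg hgc
    simp_rw [smul_eq_mul]
    rw [integral_mul_fderiv_pressure_zero hprof (h2le hg) hgc e₃]
    simp [hinner3]
  -- `P` is invariant under vertical translations
  have hPv : ∀ (s : ℝ) (y : EuclideanSpace ℝ (Fin 3)), P (y + s • e₃) = P y := by
    intro s y
    have hline : ∀ τ : ℝ, HasDerivAt (fun τ : ℝ => P (y + τ • e₃)) 0 τ := by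
      intro τ
      have h1 : HasDerivAt (fun τ : ℝ => y + τ • e₃) e₃ τ := by
        simpa using ((hasDerivAt_id τ).smul_const e₃).const_add y
      have h2 := (hPd (y + τ • e₃)).hasFDerivAt.comp_hasDerivAt τ h1
      rw [hD3] at h2
      exact h2
    have h := is_const_of_deriv_eq_zero (fun τ => (hline τ).differentiableAt) (fun τ => (hline τ).deriv) s 0
    simpa using h
  -- ### Step 3: `∇P ≡ 0`
  have hDall : ∀ (e x : EuclideanSpace ℝ (Fin 3)), fderiv ℝ P x e = 0 := by
    intro e
    refine hall_of_ae e (ae_eq_zero_of_integral_contDiff_smul_eq_zero (hDPc e).locallyIntegrable ?_)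
    intro g hg hgc
    simp_rw [smul_eq_mul]
    have hg2 : ContDiff ℝ 2 g := h2le hg
    -- the constants of the bound
    set Cg : ℝ := (|ν| * (∫ x, |(Δ g) x|) + ∫ x, ‖fderiv ℝ g x‖) * ‖e‖ with hCg_def
    have hCg : 0 ≤ Cg := by
      have hA : 0 ≤ ∫ x, |(Δ g) x| := integral_nonneg fun x => abs_nonneg _
      have hB : 0 ≤ ∫ x, ‖fderiv ℝ g x‖ := integral_nonneg fun x => norm_nonneg _
      positivity
    -- for every `η ∈ (0,1]`: `|∫ g ∂ₑP| ≤ Cg η`, through a far vertical translate of the solution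
    have hbound : ∀ η : ℝ, 0 < η → η ≤ 1 → |∫ x, g x * fderiv ℝ P x e| ≤ Cg * η := by
      intro η hη hη1
      obtain ⟨Rg, hRg⟩ := hgc.isCompact.isBounded.subset_closedBall (0 : EuclideanSpace ℝ (Fin 3))
      have hfar : ∀ᶠ y in cocompact (EuclideanSpace ℝ (Fin 3)), ‖U y‖ < η := by
        have h := hlim (Metric.ball_mem_nhds (0 : EuclideanSpace ℝ (Fin 3)) hη)
        filter_upwards [h] with y hy
        simpa using hy
      obtain ⟨K, hK, hKfar⟩ := (hasBasis_cocompact.eventually_iff).1 hfar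
      obtain ⟨R₁, hR₁⟩ := hK.isBounded.subset_closedBall (0 : EuclideanSpace ℝ (Fin 3))
      set s : ℝ := |Rg| + |R₁| + 1 with hs_def
      -- the translated solution has the same pressure
      have hprof' : IsLerayProfile ν 0 (fun y => U (y + s • e₃)) P := by
        have h := isLerayProfile_comp_add_right hprof (s • e₃)
        have hPeq : (fun y => P (y + s • e₃)) = P := funext (hPv s)
        rwa [hPeq] at h
      have hsmall : ∀ x ∈ tsupport g, ‖U (x + s • e₃)‖ ≤ η := by
        intro x hx
        have hxR : ‖x‖ ≤ Rg := by
          have := hRg hx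
          rwa [mem_closedBall, dist_zero_right] at this
        have hse : ‖s • e₃‖ = s := by
          rw [norm_smul, he₃n, mul_one, Real.norm_of_nonneg (by positivity)]
        have hbig : R₁ < ‖x + s • e₃‖ := by
          have h1 : ‖s • e₃‖ ≤ ‖x + s • e₃‖ + ‖x‖ := by
            calc ‖s • e₃‖ = ‖(x + s • e₃) - x‖ := by rw [add_sub_cancel_left]
              _ ≤ ‖x + s • e₃‖ + ‖x‖ := norm_sub_le _ _
          rw [hse] at h1
          have : R₁ ≤ |R₁| := le_abs_self _
          have : Rg ≤ |Rg| := le_abs_self _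
          linarith
        have hyc : x + s • e₃ ∈ Kᶜ := fun hmem => by
          have := hR₁ hmem
          rw [mem_closedBall, dist_zero_right] at this
          linarith
        exact (hKfar hyc).le
      have hb := abs_integral_mul_fderiv_pressure_le hprof' hg2 hgc e hη1 hsmall
      rwa [hCg_def]
    -- hence the integral vanishes
    by_contra hne
    have hI : 0 < |∫ x, g x * fderiv ℝ P x e| := abs_pos.2 hne
    set η : ℝ := min 1 (|∫ x, g x * fderiv ℝ P x e| / (2 * (Cg + 1))) with hη_def
    have hη : 0 < η := lt_min one_pos (by positivity)
    have hη1 : η ≤ 1 := min_le_left _ _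
    have hη2 : η ≤ |∫ x, g x * fderiv ℝ P x e| / (2 * (Cg + 1)) := min_le_right _ _
    have h := hbound η hη hη1
    have h3 : Cg * η ≤ Cg * (|∫ x, g x * fderiv ℝ P x e| / (2 * (Cg + 1))) := mul_le_mul_of_nonneg_left hη2 hCg
    have h4 : Cg * (|∫ x, g x * fderiv ℝ P x e| / (2 * (Cg + 1))) < |∫ x, g x * fderiv ℝ P x e| := by
      rw [mul_div_assoc', div_lt_iff₀ (by positivity)]
      nlinarith
    linarith
  -- `P` is constant
  have hfd0 : ∀ x, fderiv ℝ P x = 0 := fun x => ContinuousLinearMap.ext fun v => by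
    simpa using hDall v x
  have hPc : ∀ x, P x = P 0 := fun x => is_const_of_fderiv_eq_zero hPd hfd0 x 0
  -- ### Step 4: the head pressure `Θ = ½|U|² + P(0)` is a subsolution tending to `P(0)`; hence `Θ ≤ P(0)`
  set Θ : EuclideanSpace ℝ (Fin 3) → ℝ := headPressure 0 U P with hΘ_def
  have hΘapp : ∀ y, Θ y = 2⁻¹ * ‖U y‖ ^ 2 + P 0 := by
    intro y
    rw [hΘ_def, headPressure_apply, hPc y, zero_mul, add_zero]
  have hΘ2 : ContDiff ℝ 2 Θ := contDiff_infty.1 (hprof.contDiff_headPressure hU) 2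
  have hLΘ : ∀ y, 0 ≤ driftOp ν 0 U Θ y := fun y => hprof.driftOp_headPressure_nonneg hU hν.le y
  -- `U` is bounded
  obtain ⟨M, hM⟩ : ∃ M : ℝ, ∀ y, ‖U y‖ ≤ M := by
    have h1 : ∀ᶠ y in cocompact (EuclideanSpace ℝ (Fin 3)), ‖U y‖ < 1 := by
      have h := hlim (Metric.ball_mem_nhds (0 : EuclideanSpace ℝ (Fin 3)) one_pos)
      filter_upwards [h] with y hy
      simpa using hy
    obtain ⟨K, hK, hKfar⟩ := (hasBasis_cocompact.eventually_iff).1 h1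
    obtain ⟨M₁, hM₁⟩ := hK.exists_bound_of_continuousOn hUc.continuousOn
    refine ⟨max M₁ 1, fun y => ?_⟩
    by_cases hy : y ∈ K
    · exact (hM₁ y hy).trans (le_max_left _ _)
    · exact ((hKfar hy).le).trans (le_max_right _ _)
  -- `Θ → P 0` at infinity
  have hΘlim : Tendsto Θ (cocompact (EuclideanSpace ℝ (Fin 3))) (𝓝 (P 0)) := by
    have h1 : Tendsto (fun y => ‖U y‖) (cocompact (EuclideanSpace ℝ (Fin 3))) (𝓝 0) := by
      simpa using hlim.norm
    have h2 : Tendsto (fun y => 2⁻¹ * ‖U y‖ ^ 2 + P 0) (cocompact (EuclideanSpace ℝ (Fin 3)))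
        (𝓝 (2⁻¹ * (0 : ℝ) ^ 2 + P 0)) := ((h1.pow 2).const_mul _).add_const _
    rw [show (2⁻¹ * (0 : ℝ) ^ 2 + P 0) = P 0 by ring] at h2
    exact h2.congr' (Eventually.of_forall fun y => (hΘapp y).symm)
  have hle := le_of_driftOp_nonneg_of_tendsto hν hM hΘ2 hLΘ hΘlim
  -- conclusion
  funext x
  have hx := hle x
  rw [hΘapp x] at hx
  have hsq : ‖U x‖ ^ 2 = 0 := by nlinarith [sq_nonneg ‖U x‖]
  have hn : ‖U x‖ = 0 := pow_eq_zero_iff two_ne_zero |>.1 hsq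
  simpa using hn

end Summit.NavierStokesRegularity.NavierStokesRegularity.Theorems.GaldiLiouville.AllAxesBudget

end
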